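import Summits.CriticalPhenomena.CardyFormulaZ2.Theorems.CardyIKTransportCornerLineDescentFreezeRenewal

/-!
# The frozen end `p = 0` of the corner line: renewal probabilistics, part 2 — the good grid

Support file for the registered stub `stub_FreezeHomogenisation` of the line `symmetric-seed-second-order` of the
crux `CardyIKTransport.CornerLineDescent` (stmt-CriticalPhenomena-10964).  First, the flips of a fair bit sequence
are a.s. UNBOUNDED in both directions (no flip on `n` consecutive cells has probability `2^{-n}`), so the normalised
two-sided flip enumeration `FlipEnum.ofUnbounded` exists a.s.  The TWO-SIDED FLIP COUNT
`flipCount A m` (`#flips in (0,m]`, resp. `-#flips in (m,0]`) is the run index of the cell `m` in the normalised flip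
enumeration (`FlipEnum.runIdx_eq_flipCount`; the flips in `(a, b]` are `pos (runIdx a + 1), …, pos (runIdx b)`), so
the block index of a cell of the frozen gauge is a pair of flip counts.  From the strong law of part 1, the
SUP-DISTORTION of the renewal grid on the window `[-M, M]` is `o(M)` a.s. (`eventually_distortion_le`, deterministic),
whence the GOOD-GRID EVENT `GoodGrid A M θ` (flips unbounded both ways and `|2·flipCount m - m| ≤ θ M` for `|m| ≤ M`)
has probability `→ 1` as `M → ∞` for every tolerance `θ > 0` (anchor `tendsto_badGrid_zero`; continuity of the
measure along the tails of an a.s. eventual event).  References: Durrett, *Probability* (2019) Thm. 2.4.1; route file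
`Theses/CardyIKTransport.lean` (items 10964, 4967).
-/

noncomputable section

namespace Summit.CriticalPhenomena.CardyFormulaZ2.Theorems.CornerLineDescent.SymmetricSeed

open scoped BigOperators Topology Classical MeasureTheory ProbabilityTheory ENNReal NNReal
open Filter Set Function MeasureTheory ProbabilityTheory
open Literature.Probability.Percolation (sitePercolation half sitePi bernoulliProp)
open Literature.Probability.LatticeModels

namespace Freeze

/-! ### Flips are a.s. unbounded in both directions -/

/-- No flip on the `n` cells after `N` has probability at most `2^{-n}` (the bits on `[N, N+n]` are then all equal).
[folklore] -/
theorem measure_noFlip_Icc_le (N : ℤ) (n : ℕ) :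
    bitLaw.real {A | ∀ k ∈ Finset.Ioc N (N + n), ¬ IsFlip A k} ≤ (1 / 2 : ℝ) ^ n := by
  -- no flip on `(N, N+n]` means the bits on `[N, N+n]` are all equal to the bit at `N`
  have hsub : {A : Set ℤ | ∀ k ∈ Finset.Ioc N (N + n), ¬ IsFlip A k} ⊆
      {A | (↑(Finset.Icc N (N + n)) : Set ℤ) ⊆ A} ∪ {A | ∀ k ∈ Finset.Icc N (N + n), k ∉ A} := by
    intro A hA
    simp only [Set.mem_setOf_eq, IsFlip, not_not] at hA
    have key : ∀ m : ℕ, m ≤ n → (N + m ∈ A ↔ N ∈ A) := by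
      intro m
      induction m with
      | zero => simp
      | succ m ih =>
        intro hm
        have h1 := ih (by omega)
        have h2 := hA (N + (m + 1 : ℕ)) (by simp only [Finset.mem_Ioc]; omega)
        rw [show N + ((m + 1 : ℕ) : ℤ) - 1 = N + (m : ℕ) by push_cast; ring] at h2
        exact h2.symm.trans h1
    by_cases hN : N ∈ A
    · left
      intro k hk
      simp only [Finset.coe_Icc, Set.mem_Icc] at hk
      have := key (k - N).toNat (by omega)
      rw [show N + ((k - N).toNat : ℤ) = k by omega] at this
      exact this.2 hN
    · right
      intro k hk
      simp only [Finset.mem_Icc] at hk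
      have := key (k - N).toNat (by omega)
      rw [show N + ((k - N).toNat : ℤ) = k by omega] at this
      exact fun h => hN (this.1 h)
  have hcard : (Finset.Icc N (N + n)).card = n + 1 := by
    rw [Int.card_Icc]; omega
  have hA1 : bitLaw.real {A | (↑(Finset.Icc N (N + n)) : Set ℤ) ⊆ A} = (1 / 2 : ℝ) ^ (n + 1) := by
    rw [show bitLaw = sitePercolation ℤ half from rfl, Literature.Probability.Percolation.sitePercolation_real_subset,
      hcard, Literature.Probability.Percolation.coe_half]
  have hA2 : bitLaw.real {A | ∀ k ∈ Finset.Icc N (N + n), k ∉ A} = (1 / 2 : ℝ) ^ (n + 1) := by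
    rw [measureReal_def, show bitLaw = sitePercolation ℤ half from rfl,
      Literature.Probability.Percolation.sitePercolation_apply']
    have : ((fun χ : ℤ → Prop => {v | χ v}) ⁻¹' {ω : Set ℤ | ∀ k ∈ Finset.Icc N (N + n), k ∉ ω}) =
        Set.pi ↑(Finset.Icc N (N + n)) fun _ => {False} := by
      ext χ; simp
    rw [this, sitePi, Measure.infinitePi_pi _ (fun _ _ => measurableSet_singleton _), Finset.prod_const,
      ENNReal.toReal_pow, ← measureReal_def, Literature.Probability.Percolation.bernoulliProp_real_false,
      hcard, Literature.Probability.Percolation.coe_half]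
    norm_num
  calc bitLaw.real {A | ∀ k ∈ Finset.Ioc N (N + n), ¬ IsFlip A k}
      ≤ bitLaw.real ({A | (↑(Finset.Icc N (N + n)) : Set ℤ) ⊆ A} ∪ {A | ∀ k ∈ Finset.Icc N (N + n), k ∉ A}) :=
        measureReal_mono hsub
    _ ≤ bitLaw.real {A | (↑(Finset.Icc N (N + n)) : Set ℤ) ⊆ A} + bitLaw.real {A | ∀ k ∈ Finset.Icc N (N + n), k ∉ A} :=
        measureReal_union_le _ _
    _ = (1 / 2 : ℝ) ^ (n + 1) + (1 / 2 : ℝ) ^ (n + 1) := by rw [hA1, hA2]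
    _ = (1 / 2 : ℝ) ^ n := by ring

/-- The event of no flip above `N` is null. [folklore] -/
theorem measure_noFlip_above (N : ℤ) : bitLaw {A | ∀ k, N < k → ¬ IsFlip A k} = 0 := by
  have hle : ∀ n : ℕ, bitLaw.real {A | ∀ k, N < k → ¬ IsFlip A k} ≤ (1 / 2 : ℝ) ^ n := fun n => by
    refine le_trans (measureReal_mono ?_) (measure_noFlip_Icc_le N n)
    intro A hA k hk
    exact hA k (Finset.mem_Ioc.1 hk).1
  have h0 : bitLaw.real {A | ∀ k, N < k → ¬ IsFlip A k} ≤ 0 :=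
    ge_of_tendsto (tendsto_pow_atTop_nhds_zero_of_lt_one (by norm_num) (by norm_num)) (Eventually.of_forall hle)
  have h1 : bitLaw.real {A | ∀ k, N < k → ¬ IsFlip A k} = 0 := le_antisymm h0 measureReal_nonneg
  exact (measureReal_eq_zero_iff (measure_ne_top _ _)).1 h1

/-- A.S. THE FLIPS ARE UNBOUNDED ABOVE. [folklore] -/
theorem ae_flips_unbounded_above : ∀ᵐ A ∂bitLaw, ∀ N : ℤ, ∃ k, N < k ∧ IsFlip A k := by
  rw [ae_all_iff]
  intro N
  rw [ae_iff]
  refine measure_mono_null (fun A hA => ?_) (measure_noFlip_above N)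
  simp only [not_exists, not_and, Set.mem_setOf_eq] at hA ⊢
  exact hA

/-- A.S. THE FLIPS ARE UNBOUNDED BELOW. [folklore] -/
theorem ae_flips_unbounded_below : ∀ᵐ A ∂bitLaw, ∀ N : ℤ, ∃ k, k < N ∧ IsFlip A k := by
  have h : ∀ᵐ A ∂(bitLaw.map refl), ∀ N : ℤ, ∃ k, N < k ∧ IsFlip A k := by
    rw [map_refl]; exact ae_flips_unbounded_above
  filter_upwards [ae_of_ae_map measurable_refl.aemeasurable h] with A hA
  intro N
  obtain ⟨k, hk, hf⟩ := hA (1 - N)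
  refine ⟨1 - k, by omega, ?_⟩
  rw [isFlip_refl] at hf; exact hf

/-! ### The two-sided flip count and the sup-distortion of the grid -/

/-- THE TWO-SIDED FLIP COUNT: `#flips in (0, m]` for `m ≥ 0`, `-#flips in (m, 0]` for `m < 0`. [folklore] -/
def flipCount (A : Set ℤ) (m : ℤ) : ℤ :=
  if 0 ≤ m then (posCount A m.toNat : ℤ) else -(negCount A (-m).toNat : ℤ)

namespace FlipEnum

variable {A : Set ℤ} (e : FlipEnum A)

/-- `pos i ≤ m ↔ i ≤ runIdx m`: the run index is the upper adjoint of the enumeration. [folklore] -/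
theorem pos_le_iff (i m : ℤ) : e.pos i ≤ m ↔ i ≤ e.runIdx m :=
  ⟨fun h => le_csSup (e.bddAbove_le m) h, fun h => (e.strictMono.monotone h).trans (e.pos_runIdx_le m)⟩

/-- THE FLIPS IN `(a, b]` ARE `pos (runIdx a + 1), …, pos (runIdx b)`: there are `runIdx b - runIdx a` of them.
[folklore] -/
theorem card_filter_isFlip_Ioc (a b : ℤ) :
    ((Finset.Ioc a b).filter fun k => IsFlip A k).card = (e.runIdx b - e.runIdx a).toNat := by
  rw [← Int.card_Ioc]
  symm
  refine Finset.card_bij (fun i _ => e.pos i) ?_ ?_ ?_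
  · intro i hi
    simp only [Finset.mem_Ioc] at hi
    simp only [Finset.mem_filter, Finset.mem_Ioc]
    refine ⟨⟨?_, (e.pos_le_iff i b).2 hi.2⟩, (e.isFlip_iff _).2 ⟨i, rfl⟩⟩
    by_contra h
    push Not at h
    have := (e.pos_le_iff i a).1 h
    omega
  · intro i _ j _ h
    exact e.strictMono.injective h
  · intro k hk
    simp only [Finset.mem_filter, Finset.mem_Ioc] at hk
    obtain ⟨i, rfl⟩ := (e.isFlip_iff k).1 hk.2
    refine ⟨i, ?_, rfl⟩
    simp only [Finset.mem_Ioc]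
    refine ⟨?_, (e.pos_le_iff i b).1 hk.1.2⟩
    by_contra h
    push Not at h
    have := (e.pos_le_iff i a).2 h
    omega

/-- THE RUN INDEX IS THE FLIP COUNT for an enumeration normalised by `pos 0 ≤ 0 < pos 1` (e.g. `ofUnbounded`):
`runIdx m = flipCount A m`. [folklore] -/
theorem runIdx_eq_flipCount (h0 : e.pos 0 ≤ 0 ∧ 0 < e.pos 1) (m : ℤ) : e.runIdx m = flipCount A m := by
  have hr0 : e.runIdx 0 = 0 := e.runIdx_eq_iff.2 ⟨h0.1, by simpa using h0.2⟩
  unfold flipCount posCount negCount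
  split_ifs with hm
  · have h := e.card_filter_isFlip_Ioc 0 m
    rw [hr0, sub_zero] at h
    have hmono : 0 ≤ e.runIdx m := hr0 ▸ e.runIdx_mono hm
    rw [Int.toNat_of_nonneg hm, h, Int.toNat_of_nonneg hmono]
  · push Not at hm
    have h := e.card_filter_isFlip_Ioc m 0
    rw [hr0, zero_sub] at h
    have hmono : e.runIdx m ≤ 0 := hr0 ▸ e.runIdx_mono hm.le
    rw [show (((-m).toNat : ℕ) : ℤ) = -m from Int.toNat_of_nonneg (by omega), neg_neg, h,
      Int.toNat_of_nonneg (by omega)]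
    ring

end FlipEnum

/-- `posCount` as a sum of flip indicators. [folklore] -/
theorem posCount_eq_sum (A : Set ℤ) (n : ℕ) : (posCount A n : ℝ) = ∑ k ∈ Finset.Ioc (0:ℤ) n, flipInd k A := by
  unfold posCount flipInd
  rw [Finset.natCast_card_filter]

/-- `negCount` as a sum of flip indicators. [folklore] -/
theorem negCount_eq_sum (A : Set ℤ) (n : ℕ) : (negCount A n : ℝ) = ∑ k ∈ Finset.Ioc (-(n:ℤ)) 0, flipInd k A := by
  unfold negCount flipInd
  rw [Finset.natCast_card_filter]

/-- `posCount` is measurable. [folklore] -/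
theorem measurable_posCount (n : ℕ) : Measurable fun A => (posCount A n : ℝ) := by
  simp_rw [posCount_eq_sum]
  exact Finset.measurable_sum _ fun k _ => measurable_flipInd k

/-- `negCount` is measurable. [folklore] -/
theorem measurable_negCount (n : ℕ) : Measurable fun A => (negCount A n : ℝ) := by
  simp_rw [negCount_eq_sum]
  exact Finset.measurable_sum _ fun k _ => measurable_flipInd k

/-- `flipCount` is measurable. [folklore] -/
theorem measurable_flipCount (m : ℤ) : Measurable fun A => (flipCount A m : ℝ) := by
  unfold flipCount
  split_ifs
  · simp only [Int.cast_natCast]; exact measurable_posCount _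
  · simp only [Int.cast_neg, Int.cast_natCast]; exact (measurable_negCount _).neg

/-- At most one flip per cell, to the left. [folklore] -/
theorem negCount_le (A : Set ℤ) (n : ℕ) : negCount A n ≤ n := by
  rw [negCount_eq_posCount_refl]; exact posCount_le _ _

/-- `|2c - n| ≤ n` for `0 ≤ c ≤ n`. [folklore] -/
theorem abs_two_mul_sub_le {c n : ℝ} (h0 : 0 ≤ c) (h1 : c ≤ n) : |2 * c - n| ≤ n := by
  rw [abs_le]; constructor <;> linarith

/-- FROM DENSITIES TO SUP-DISTORTION (deterministic): if the flip densities to the right and to the left tend to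
`1/2`, then for every `θ > 0`, eventually in `M`, `|2·flipCount m - m| ≤ θ M` for all `|m| ≤ M`. [folklore] -/
theorem eventually_distortion_le {A : Set ℤ}
    (hp : Tendsto (fun n : ℕ => (posCount A n : ℝ) / n) atTop (𝓝 (1 / 2)))
    (hn : Tendsto (fun n : ℕ => (negCount A n : ℝ) / n) atTop (𝓝 (1 / 2))) {θ : ℝ} (hθ : 0 < θ) :
    ∀ᶠ M : ℕ in atTop, ∀ m : ℤ, |m| ≤ M → |2 * (flipCount A m : ℝ) - m| ≤ θ * M := by
  -- uniform control beyond `N`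
  have hev : ∀ {f : ℕ → ℕ}, (∀ n, f n ≤ n) → Tendsto (fun n : ℕ => (f n : ℝ) / n) atTop (𝓝 (1 / 2)) →
      ∃ N : ℕ, ∀ n, N ≤ n → |2 * (f n : ℝ) - n| ≤ θ * n := by
    intro f hf h
    have h' := (Metric.tendsto_atTop.1 h) (θ / 2) (by positivity)
    obtain ⟨N, hN⟩ := h'
    refine ⟨N + 1, fun n hn => ?_⟩
    have hn0 : (0:ℝ) < n := by exact_mod_cast (show 0 < n by omega)
    have := hN n (by omega)
    rw [Real.dist_eq, abs_lt] at this
    obtain ⟨h1, h2⟩ := this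
    rw [abs_le]
    constructor
    · have : -(θ / 2) * n < ((f n : ℝ) / n - 1 / 2) * n := by nlinarith
      rw [sub_mul, div_mul_cancel₀ _ hn0.ne'] at this
      nlinarith
    · have : ((f n : ℝ) / n - 1 / 2) * n < (θ / 2) * n := by nlinarith
      rw [sub_mul, div_mul_cancel₀ _ hn0.ne'] at this
      nlinarith
  obtain ⟨N₁, hN₁⟩ := hev (posCount_le A) hp
  obtain ⟨N₂, hN₂⟩ := hev (negCount_le A) hn
  -- bound valid for all `n ≤ M` once `θ M ≥ max N₁ N₂`
  have key : ∀ {f : ℕ → ℕ} {N : ℕ}, (∀ n, f n ≤ n) → (∀ n, N ≤ n → |2 * (f n : ℝ) - n| ≤ θ * n) →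
      ∀ M : ℕ, (N : ℝ) ≤ θ * M → ∀ n : ℕ, n ≤ M → |2 * (f n : ℝ) - n| ≤ θ * M := by
    intro f N hf hN M hM n hnM
    rcases le_or_gt N n with h | h
    · exact (hN n h).trans (by gcongr)
    · calc |2 * (f n : ℝ) - n| ≤ n := abs_two_mul_sub_le (by positivity) (by exact_mod_cast hf n)
        _ ≤ N := by exact_mod_cast h.le
        _ ≤ θ * M := hM
  have hM : ∀ᶠ M : ℕ in atTop, ((max N₁ N₂ : ℕ) : ℝ) ≤ θ * M :=
    ((tendsto_natCast_atTop_atTop (R := ℝ)).const_mul_atTop hθ).eventually_ge_atTop _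
  filter_upwards [hM] with M hM m hm
  have hM1 : (N₁ : ℝ) ≤ θ * M := le_trans (by exact_mod_cast le_max_left _ _) hM
  have hM2 : (N₂ : ℝ) ≤ θ * M := le_trans (by exact_mod_cast le_max_right _ _) hM
  unfold flipCount
  split_ifs with h0
  · have habs := abs_le.1 hm
    have h1 := key (posCount_le A) hN₁ M hM1 m.toNat (by omega)
    have hm' : ((m.toNat : ℕ) : ℝ) = (m : ℝ) := by exact_mod_cast Int.toNat_of_nonneg h0
    simp only [Int.cast_natCast]
    rwa [hm'] at h1
  · have habs := abs_le.1 hm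
    have h1 := key (negCount_le A) hN₂ M hM2 (-m).toNat (by omega)
    have hm' : (((-m).toNat : ℕ) : ℝ) = -(m : ℝ) := by
      have : (((-m).toNat : ℕ) : ℤ) = -m := Int.toNat_of_nonneg (by omega)
      exact_mod_cast this
    simp only [Int.cast_neg, Int.cast_natCast]
    rw [hm'] at h1
    rw [show 2 * -((negCount A (-m).toNat : ℕ) : ℝ) - m = -(2 * (negCount A (-m).toNat : ℝ) - -(m:ℝ)) by ring,
      abs_neg]
    exact h1

/-- `THE GOOD-GRID EVENT` at window `M` and tolerance `θ`: flips unbounded in both directions (so the normalised flip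
enumeration exists) and sup-distortion `|2·flipCount m - m| ≤ θ M` for `|m| ≤ M`. [folklore] -/
def GoodGrid (A : Set ℤ) (M : ℕ) (θ : ℝ) : Prop :=
  (∀ N : ℤ, ∃ k, N < k ∧ IsFlip A k) ∧ (∀ N : ℤ, ∃ k, k < N ∧ IsFlip A k) ∧
    ∀ m : ℤ, |m| ≤ M → |2 * (flipCount A m : ℝ) - m| ≤ θ * M

/-- The good-grid event is measurable. [folklore] -/
theorem measurableSet_goodGrid (M : ℕ) (θ : ℝ) : MeasurableSet {A | GoodGrid A M θ} := by
  unfold GoodGrid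
  refine MeasurableSet.inter ?_ (MeasurableSet.inter ?_ ?_)
  · refine measurableSet_setOf.2 (Measurable.forall fun N => Measurable.exists fun k => ?_)
    exact measurable_const.and (measurableSet_setOf.1 (measurableSet_isFlip k))
  · refine measurableSet_setOf.2 (Measurable.forall fun N => Measurable.exists fun k => ?_)
    exact measurable_const.and (measurableSet_setOf.1 (measurableSet_isFlip k))
  · refine measurableSet_setOf.2 (Measurable.forall fun m => Measurable.imp measurable_const ?_)
    exact measurableSet_setOf.1 (measurableSet_le (((measurable_flipCount m).const_mul 2).sub_const _).abs
      measurable_const)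

/-- A.S. THE GRID IS EVENTUALLY GOOD at every tolerance. [folklore] -/
theorem ae_eventually_goodGrid {θ : ℝ} (hθ : 0 < θ) : ∀ᵐ A ∂bitLaw, ∀ᶠ M in atTop, GoodGrid A M θ := by
  filter_upwards [ae_flips_unbounded_above, ae_flips_unbounded_below, ae_tendsto_posCount_div,
    ae_tendsto_negCount_div] with A h1 h2 h3 h4
  filter_upwards [eventually_distortion_le h3 h4 hθ] with M hM
  exact ⟨h1, h2, hM⟩

/-- From "a.s. eventually outside" to "measure tends to zero" (continuity from above along the tails). [folklore] -/
theorem tendsto_measure_of_ae_eventually_notMem {s : ℕ → Set (Set ℤ)} (hs : ∀ M, MeasurableSet (s M))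
    (h : ∀ᵐ A ∂bitLaw, ∀ᶠ M in atTop, A ∉ s M) : Tendsto (fun M => bitLaw (s M)) atTop (𝓝 0) := by
  set t : ℕ → Set (Set ℤ) := fun M => ⋃ M', ⋃ (_ : M ≤ M'), s M' with ht
  have hanti : Antitone t := by
    intro M₁ M₂ h12
    simp only [ht]
    exact Set.iUnion_mono fun M' => Set.iUnion_subset fun hM' => Set.subset_iUnion (fun _ : M₁ ≤ M' => s M') (h12.trans hM')
  have hmeas : ∀ M, NullMeasurableSet (t M) bitLaw := fun M =>
    (MeasurableSet.iUnion fun M' => MeasurableSet.iUnion fun _ => hs M').nullMeasurableSet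
  have hnull : bitLaw (⋂ M, t M) = 0 := by
    rw [ae_iff] at h
    refine measure_mono_null (fun A hA => ?_) h
    simp only [Set.mem_iInter, ht, Set.mem_iUnion] at hA
    simp only [Set.mem_setOf_eq, Filter.eventually_atTop, not_exists, not_forall]
    intro M
    obtain ⟨M', hM', hA'⟩ := hA M
    exact ⟨M', hM', not_not.2 hA'⟩
  have hlim := tendsto_measure_iInter_atTop hmeas hanti ⟨0, measure_ne_top _ _⟩
  rw [hnull] at hlim
  refine tendsto_of_tendsto_of_tendsto_of_le_of_le tendsto_const_nhds hlim (fun M => bot_le) fun M => ?_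
  exact measure_mono (Set.subset_iUnion_of_subset M (Set.subset_iUnion_of_subset le_rfl Subset.rfl))

/-- THE BAD-GRID PROBABILITY VANISHES: for every tolerance `θ > 0`, `P[¬ GoodGrid · M θ] → 0` as `M → ∞`. [folklore] -/
theorem tendsto_measure_not_goodGrid {θ : ℝ} (hθ : 0 < θ) :
    Tendsto (fun M : ℕ => bitLaw {A | ¬ GoodGrid A M θ}) atTop (𝓝 0) :=
  tendsto_measure_of_ae_eventually_notMem (fun M => (measurableSet_goodGrid M θ).compl)
    ((ae_eventually_goodGrid hθ).mono fun _ hA => hA.mono fun _ hM => not_not.2 hM)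

end Freeze

/-- ANCHOR (registered sub-goal). THE BAD-GRID PROBABILITY VANISHES: for every tolerance `θ > 0`, the probability under
the fair bit measure that the grid is not good at window `M` tends to `0` as `M → ∞`. [folklore] -/
theorem tendsto_badGrid_zero : ∀ (θ : ℝ), 0 < θ → Tendsto (fun M : ℕ => (sitePercolation ℤ half) {A | ¬ Freeze.GoodGrid A M θ}) atTop (𝓝 0) :=
  fun _ hθ => Freeze.tendsto_measure_not_goodGrid hθ

end Summit.CriticalPhenomena.CardyFormulaZ2.Theorems.CornerLineDescent.SymmetricSeed
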